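import Summits.PneNP.PneNP.Theorems.ConvexRankGatesConvexGateBlindExactLiftingTriangleLineCover

/-!
# Triangle instance — line isolation, file 1: counting colourings of one block

Support file for crux `ConvexGateBlind` (stmt-PneNP-10680), line `xor-door-perfect-completeness`, open stub
`stub_exactLifting`; prover seat 0, session 22, memo ANALYSIS12 (Theorem B: ε-uniform isolation of the line
factorisation of the triangle matrix `M_t`). This file: the halving lemma (prescribing the colour of one more vertex
halves a flip-invariant count) and the one-block sums it feeds — colourings `y : Fin t → Bool` of one block with
prescribed colours at `≤ 4` vertices, the "different-colour count" `dc y v₀ = #{v : y v ≠ y v₀}`, and the class-size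
product `#A_y · #B_y`.
-/

set_option linter.dupNamespace false -- `Summit.PneNP.PneNP.…`: summit = sub-problem (D-0017)

namespace Summit.PneNP.PneNP.Theorems.XorDoor.TriLine

open Finset

variable {t : ℕ}

/-! ## Flipping one vertex; the halving lemma -/

/-- flip the colour of the vertex `a` -/
def flipAt (a : Fin t) (y : Fin t → Bool) : Fin t → Bool := Function.update y a (!y a)

/-- the flipped vertex changes colour -/
@[simp] lemma flipAt_apply_same (a : Fin t) (y : Fin t → Bool) : flipAt a y a = !y a := by
  simp [flipAt]

/-- the other vertices keep their colour -/
@[simp] lemma flipAt_apply_ne {a v : Fin t} (h : v ≠ a) (y : Fin t → Bool) : flipAt a y v = y v := by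
  simp [flipAt, h]

/-- flipping twice is the identity -/
lemma flipAt_involutive (a : Fin t) : Function.Involutive (flipAt (t := t) a) := by
  intro y
  funext v
  by_cases h : v = a
  · subst h; simp
  · simp [h]

/-- **Halving.** If `P` is invariant under flipping the vertex `a`, prescribing the colour of `a` halves `#{y | P y}`. -/
lemma two_mul_card_fix (a : Fin t) (c : Bool) (P : (Fin t → Bool) → Prop) [DecidablePred P]
    (hP : ∀ y, P (flipAt a y) ↔ P y) :
    2 * #(univ.filter fun y => y a = c ∧ P y) = #(univ.filter P) := by
  set A := univ.filter fun y : Fin t → Bool => y a = c ∧ P y with hA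
  set B := univ.filter fun y : Fin t → Bool => y a = !c ∧ P y with hB
  have h1 : #A = #B := by
    refine card_bij (fun y _ => flipAt a y) ?_ ?_ ?_
    · intro y hy
      simp only [hA, hB, mem_filter, mem_univ, true_and] at hy ⊢
      exact ⟨by simp [hy.1], (hP y).2 hy.2⟩
    · intro y _ y' _ h
      exact (flipAt_involutive a).injective h
    · intro y hy
      simp only [hB, mem_filter, mem_univ, true_and] at hy
      refine ⟨flipAt a y, ?_, flipAt_involutive a y⟩
      simp only [hA, mem_filter, mem_univ, true_and]
      exact ⟨by simp [hy.1], (hP _).2 hy.2⟩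
  have hdisj : Disjoint A B := by
    rw [hA, hB, disjoint_filter]
    intro y _ h h'
    rw [h.1] at h'
    cases c <;> simp at h'
  have hunion : A ∪ B = univ.filter P := by
    ext y
    simp only [hA, hB, mem_union, mem_filter, mem_univ, true_and]
    constructor
    · rintro (h | h) <;> exact h.2
    · intro h
      cases hy : y a <;> cases c <;> simp [h]
  calc 2 * #A = #A + #B := by rw [two_mul, h1]
    _ = #(A ∪ B) := (card_union_of_disjoint hdisj).symm
    _ = #(univ.filter P) := by rw [hunion]

/-- all colourings of a block: `2^t` -/
lemma card_colourings : #(univ : Finset (Fin t → Bool)) = 2 ^ t := by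
  simp

/-- one prescribed vertex: `2 · #{y | y a = c} = 2^t` -/
lemma two_mul_card_fix1 (a : Fin t) (c : Bool) :
    2 * #(univ.filter fun y : Fin t → Bool => y a = c) = 2 ^ t := by
  have h := two_mul_card_fix a c (fun _ => True) (fun _ => Iff.rfl)
  have hu : (univ.filter fun _ : Fin t → Bool => True) = univ := by ext; simp
  simp only [and_true] at h
  rw [h, hu, card_colourings]

/-- two prescribed vertices: `4 · #{y | y a₁ = c₁ ∧ y a₂ = c₂} = 2^t` -/
lemma four_mul_card_fix2 {a₁ a₂ : Fin t} (h : a₁ ≠ a₂) (c₁ c₂ : Bool) :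
    4 * #(univ.filter fun y : Fin t → Bool => y a₁ = c₁ ∧ y a₂ = c₂) = 2 ^ t := by
  have h1 := two_mul_card_fix a₁ c₁ (fun y => y a₂ = c₂) (fun y => by rw [flipAt_apply_ne h.symm])
  have h2 := two_mul_card_fix1 (t := t) a₂ c₂
  calc 4 * #(univ.filter fun y : Fin t → Bool => y a₁ = c₁ ∧ y a₂ = c₂)
      = 2 * (2 * #(univ.filter fun y : Fin t → Bool => y a₁ = c₁ ∧ y a₂ = c₂)) := by ring
    _ = 2 ^ t := by rw [h1, h2]

/-- three prescribed vertices: `8 · #{…} = 2^t` -/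
lemma eight_mul_card_fix3 {a₁ a₂ a₃ : Fin t} (h12 : a₁ ≠ a₂) (h13 : a₁ ≠ a₃) (h23 : a₂ ≠ a₃)
    (c₁ c₂ c₃ : Bool) :
    8 * #(univ.filter fun y : Fin t → Bool => y a₁ = c₁ ∧ (y a₂ = c₂ ∧ y a₃ = c₃)) = 2 ^ t := by
  have h1 := two_mul_card_fix a₁ c₁ (fun y => y a₂ = c₂ ∧ y a₃ = c₃)
    (fun y => by rw [flipAt_apply_ne h12.symm, flipAt_apply_ne h13.symm])
  have h2 := four_mul_card_fix2 (t := t) h23 c₂ c₃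
  calc 8 * #(univ.filter fun y : Fin t → Bool => y a₁ = c₁ ∧ (y a₂ = c₂ ∧ y a₃ = c₃))
      = 4 * (2 * #(univ.filter fun y : Fin t → Bool => y a₁ = c₁ ∧ (y a₂ = c₂ ∧ y a₃ = c₃))) := by ring
    _ = 2 ^ t := by rw [h1, h2]

/-- four prescribed vertices: `16 · #{…} = 2^t` -/
lemma sixteen_mul_card_fix4 {a₁ a₂ a₃ a₄ : Fin t} (h12 : a₁ ≠ a₂) (h13 : a₁ ≠ a₃) (h14 : a₁ ≠ a₄)
    (h23 : a₂ ≠ a₃) (h24 : a₂ ≠ a₄) (h34 : a₃ ≠ a₄) (c₁ c₂ c₃ c₄ : Bool) :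
    16 * #(univ.filter fun y : Fin t → Bool => y a₁ = c₁ ∧ (y a₂ = c₂ ∧ (y a₃ = c₃ ∧ y a₄ = c₄))) = 2 ^ t := by
  have h1 := two_mul_card_fix a₁ c₁ (fun y => y a₂ = c₂ ∧ (y a₃ = c₃ ∧ y a₄ = c₄))
    (fun y => by rw [flipAt_apply_ne h12.symm, flipAt_apply_ne h13.symm, flipAt_apply_ne h14.symm])
  have h2 := eight_mul_card_fix3 (t := t) h23 h24 h34 c₂ c₃ c₄
  calc 16 * #(univ.filter fun y : Fin t → Bool => y a₁ = c₁ ∧ (y a₂ = c₂ ∧ (y a₃ = c₃ ∧ y a₄ = c₄)))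
      = 8 * (2 * #(univ.filter fun y : Fin t → Bool => y a₁ = c₁ ∧ (y a₂ = c₂ ∧ (y a₃ = c₃ ∧ y a₄ = c₄)))) := by
        ring
    _ = 2 ^ t := by rw [h1, h2]


/-! ## One-block quantities: different-colour count and class-size product -/

/-- `dc y v₀ = #{v : y v ≠ y v₀}`, the number of vertices coloured differently from `v₀` -/
def dc (y : Fin t → Bool) (v₀ : Fin t) : ℕ := #(univ.filter fun v => y v ≠ y v₀)

/-- `cp y = #A_y · #B_y`, the product of the two colour-class sizes -/
def cp (y : Fin t → Bool) : ℕ := #(cls y true) * #(cls y false)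

/-- `dc` as a class size -/
lemma dc_eq_card_cls (y : Fin t → Bool) (v₀ : Fin t) : dc y v₀ = #(cls y (!y v₀)) := by
  unfold dc cls
  congr 1
  ext v
  simp only [mem_filter, mem_univ, true_and]
  cases y v <;> cases y v₀ <;> simp

/-- `cp` does not depend on which colour is called `true` -/
lemma cp_eq (y : Fin t → Bool) (c : Bool) : cp y = #(cls y c) * #(cls y (!c)) := by
  cases c
  · simp [cp, mul_comm]
  · simp [cp]

/-- `cp` is invariant under flipping all colours -/
lemma cp_not (y : Fin t → Bool) : cp (fun v => !y v) = cp y := by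
  have h : ∀ c, cls (fun v => !y v) c = cls y (!c) := by
    intro c; ext v; simp only [mem_cls]; cases y v <;> cases c <;> simp
  simp only [cp, h, Bool.not_true, Bool.not_false, mul_comm]

/-- `dc` is invariant under flipping all colours -/
lemma dc_not (y : Fin t → Bool) (v₀ : Fin t) : dc (fun v => !y v) v₀ = dc y v₀ := by
  unfold dc
  congr 1
  ext v
  simp

/-- `∑_{v₀} dc y v₀ = 2 · cp y` (ordered pairs of differently coloured vertices) -/
lemma sum_dc (y : Fin t → Bool) : ∑ v₀, dc y v₀ = 2 * cp y := by
  rw [← sum_filter_add_sum_filter_not univ (fun v₀ => y v₀ = true)]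
  have h1 : ∑ v₀ ∈ univ.filter (fun v₀ => y v₀ = true), dc y v₀ = #(cls y true) * #(cls y false) := by
    rw [← show ∑ v₀ ∈ cls y true, #(cls y false) = #(cls y true) * #(cls y false) by simp]
    refine sum_congr rfl fun v₀ hv₀ => ?_
    rw [mem_cls] at hv₀
    rw [dc_eq_card_cls, hv₀, Bool.not_true]
  have h2 : ∑ v₀ ∈ univ.filter (fun v₀ => ¬ y v₀ = true), dc y v₀ = #(cls y false) * #(cls y true) := by
    have hf : univ.filter (fun v₀ => ¬ y v₀ = true) = cls y false := by
      ext v₀; simp [cls]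
    rw [hf, ← show ∑ v₀ ∈ cls y false, #(cls y true) = #(cls y false) * #(cls y true) by simp]
    refine sum_congr rfl fun v₀ hv₀ => ?_
    rw [mem_cls] at hv₀
    rw [dc_eq_card_cls, hv₀, Bool.not_false]
  rw [h1, h2, cp]
  ring

/-- `∑_d (±) dc y d = 0` with sign `−` exactly on the class of `α`: the two cross terms cancel -/
lemma sum_sign_mul_dc (y : Fin t → Bool) (α : Bool) :
    ∑ d, (if y d = α then (-1 : ℝ) else 1) * (dc y d : ℝ) = 0 := by
  rw [← sum_filter_add_sum_filter_not univ (fun d => y d = α)]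
  have h1 : ∑ d ∈ univ.filter (fun d => y d = α), (if y d = α then (-1 : ℝ) else 1) * (dc y d : ℝ)
      = -(#(cls y α) * #(cls y (!α)) : ℝ) := by
    have : ∑ d ∈ cls y α, (-(#(cls y (!α)) : ℝ)) = -(#(cls y α) * #(cls y (!α)) : ℝ) := by
      simp
    rw [← this]
    refine sum_congr (by ext d; simp [cls]) fun d hd => ?_
    rw [mem_cls] at hd
    rw [if_pos hd, dc_eq_card_cls, hd]
    ring
  have h2 : ∑ d ∈ univ.filter (fun d => ¬ y d = α), (if y d = α then (-1 : ℝ) else 1) * (dc y d : ℝ)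
      = (#(cls y (!α)) * #(cls y α) : ℝ) := by
    have : ∑ d ∈ cls y (!α), (#(cls y α) : ℝ) = (#(cls y (!α)) * #(cls y α) : ℝ) := by simp
    rw [← this]
    have hf : univ.filter (fun d => ¬ y d = α) = cls y (!α) := by
      ext d
      simp only [mem_filter, mem_univ, true_and, mem_cls]
      cases y d <;> cases α <;> simp
    refine sum_congr hf fun d hd => ?_
    rw [mem_cls] at hd
    have hne : ¬ y d = α := by rw [hd]; cases α <;> simp
    rw [if_neg hne, dc_eq_card_cls, hd, Bool.not_not]
    ring
  rw [h1, h2]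
  ring

/-- `∑_y (±) dc y d = 0` with sign `−` exactly when `y d = u` (the involution `y ↦ ¬y`) -/
lemma sum_sign_mul_dc_eq_zero (d : Fin t) (u : Bool) :
    ∑ y : Fin t → Bool, (if y d = u then (-1 : ℝ) else 1) * (dc y d : ℝ) = 0 := by
  set S := ∑ y : Fin t → Bool, (if y d = u then (-1 : ℝ) else 1) * (dc y d : ℝ) with hS
  have h : S = -S := by
    rw [hS, ← sum_neg_distrib]
    refine Fintype.sum_bijective (fun y v => !y v)
      (Function.Involutive.bijective fun y => by funext v; simp) _ _ fun y => ?_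
    rw [dc_not]
    cases hy : y d <;> cases u <;> simp [hy]
  linarith

/-! ## Block sums -/

/-- `2 ∑_y dc y v₀ = (t−1) 2^t` -/
lemma two_mul_sum_dc (v₀ : Fin t) : 2 * ∑ y : Fin t → Bool, dc y v₀ = (t - 1) * 2 ^ t := by
  have key : ∀ v, v ≠ v₀ → 2 * #(univ.filter fun y : Fin t → Bool => y v ≠ y v₀) = 2 ^ t := by
    intro v hv
    have hsplit : (univ.filter fun y : Fin t → Bool => y v ≠ y v₀)
        = (univ.filter fun y : Fin t → Bool => y v₀ = true ∧ y v = false)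
          ∪ (univ.filter fun y : Fin t → Bool => y v₀ = false ∧ y v = true) := by
      ext y
      simp only [mem_filter, mem_univ, true_and, mem_union]
      cases y v <;> cases y v₀ <;> simp
    have hdisj : Disjoint (univ.filter fun y : Fin t → Bool => y v₀ = true ∧ y v = false)
        (univ.filter fun y : Fin t → Bool => y v₀ = false ∧ y v = true) := by
      rw [disjoint_filter]
      intro y _ h h'
      rw [h.1] at h'
      simp at h'
    have h1 := four_mul_card_fix2 (t := t) hv.symm true false
    have h2 := four_mul_card_fix2 (t := t) hv.symm false true
    rw [hsplit, card_union_of_disjoint hdisj]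
    omega
  calc 2 * ∑ y : Fin t → Bool, dc y v₀
      = 2 * ∑ y : Fin t → Bool, ∑ v, (if y v ≠ y v₀ then 1 else 0) := by
        simp only [dc, card_filter]
    _ = ∑ v, 2 * #(univ.filter fun y : Fin t → Bool => y v ≠ y v₀) := by
        rw [sum_comm, mul_sum]
        simp only [card_filter]
    _ = ∑ v ∈ univ.erase v₀, 2 ^ t := by
        rw [← sum_erase_add _ _ (mem_univ v₀)]
        have h0 : (univ.filter fun y : Fin t → Bool => y v₀ ≠ y v₀) = ∅ := by
          rw [filter_eq_empty_iff]; intro y _ h; exact h rfl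
        rw [h0, card_empty, mul_zero, add_zero]
        exact sum_congr rfl fun v hv => key v (ne_of_mem_erase hv)
    _ = (t - 1) * 2 ^ t := by
        rw [sum_const, card_erase_of_mem (mem_univ v₀), card_univ, Fintype.card_fin, smul_eq_mul]

/-- `4 ∑_y cp y = t (t−1) 2^t` -/
lemma four_mul_sum_cp : 4 * ∑ y : Fin t → Bool, cp y = t * (t - 1) * 2 ^ t := by
  have hcp : ∀ y : Fin t → Bool, cp y = ∑ p : Fin t × Fin t, (if y p.1 = true ∧ y p.2 = false then 1 else 0) := by
    intro y
    rw [cp, cls, cls, card_filter, card_filter, sum_mul_sum, ← univ_product_univ, sum_product]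
    refine sum_congr rfl fun v _ => sum_congr rfl fun v' _ => ?_
    split_ifs <;> simp_all
  calc 4 * ∑ y : Fin t → Bool, cp y
      = ∑ p : Fin t × Fin t, 4 * #(univ.filter fun y : Fin t → Bool => y p.1 = true ∧ y p.2 = false) := by
        simp only [hcp]
        rw [sum_comm, mul_sum]
        simp only [card_filter]
    _ = ∑ p ∈ (univ : Finset (Fin t)).offDiag, 2 ^ t := by
        rw [← sum_subset (subset_univ ((univ : Finset (Fin t)).offDiag))]
        · refine sum_congr rfl fun p hp => ?_
          rw [mem_offDiag] at hp
          exact four_mul_card_fix2 hp.2.2 true false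
        · intro p _ hp
          rw [mem_offDiag] at hp
          simp only [mem_univ, true_and, not_not] at hp
          rw [mul_eq_zero]; right
          rw [card_eq_zero, filter_eq_empty_iff]
          intro y _ h
          rw [hp, h.2] at h
          simp at h
    _ = t * (t - 1) * 2 ^ t := by
        rw [sum_const, offDiag_card, card_univ, Fintype.card_fin, smul_eq_mul, Nat.mul_sub_one]

/-- prescribing one colour halves `∑ cp` (the involution `y ↦ ¬y` swaps the two classes) -/
lemma two_mul_sum_cp_fix (a : Fin t) (c : Bool) :
    2 * ∑ y ∈ univ.filter (fun y : Fin t → Bool => y a = c), cp y = ∑ y : Fin t → Bool, cp y := by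
  have h1 : ∑ y ∈ univ.filter (fun y : Fin t → Bool => y a = c), cp y
      = ∑ y ∈ univ.filter (fun y : Fin t → Bool => y a = !c), cp y := by
    refine sum_bij (fun y _ => fun v => !y v) ?_ ?_ ?_ ?_
    · intro y hy
      simp only [mem_filter, mem_univ, true_and] at hy ⊢
      simp [hy]
    · intro y _ y' _ h
      funext v
      have := congr_fun h v
      simpa using this
    · intro y hy
      simp only [mem_filter, mem_univ, true_and] at hy
      refine ⟨fun v => !y v, ?_, ?_⟩
      · simp only [mem_filter, mem_univ, true_and]; simp [hy]
      · funext v; simp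
    · intro y _
      exact (cp_not y).symm
  rw [two_mul]
  conv_lhs => rw [h1]; arg 1; rw [← h1]
  rw [← sum_filter_add_sum_filter_not univ (fun y : Fin t → Bool => y a = c)]
  congr 1
  refine sum_congr ?_ fun _ _ => rfl
  ext y
  simp only [mem_filter, mem_univ, true_and]
  cases y a <;> cases c <;> simp


/-- **Class-size product over all colourings of one block** — registered sub-goal `block_class_product_sum` of
stmt-PneNP-10680, verbatim signature (see `four_mul_sum_cp`): `4 ∑_y #A_y #B_y = t (t−1) 2^t`. -/
theorem block_class_product_sum : ∀ t : ℕ, 4 * ∑ y : Fin t → Bool, (Finset.univ.filter fun v => y v = true).card *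
    (Finset.univ.filter fun v => y v = false).card = t * (t - 1) * 2 ^ t :=
  fun _ => four_mul_sum_cp

end Summit.PneNP.PneNP.Theorems.XorDoor.TriLine
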